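import Mathlib
import HarnessLib
import Literature.AlgebraicGeometry.Resolution.AlterationsStrong
import Summits.ResolutionOfSingularities.ResolutionOfSingularities.Theorems.WildQuotientsWildQuotientResolutionS1aPrincipalCentreWins

/-!
# S1a — THE TWO-PHASE REDUCTION `wins_of_killOrAux` and the residual `KillOrAuxRule` (STRATEGY-DESIGN v3.1 §2)

[OURS · L1 W4.5c · lead-1 g7; plan-1 ASSIGNMENT v10.5 (2), SIG `L/w45c/W45cKillOrAux.lean` 961629f7cb64dda5 (plan-1, statements)]
— NOT statements of the manuscript; counted 0; AI-level work, weaker than expert review. Crux stmt-ResolutionOfSingularities-17941,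
line `s1a-logminvertex` v6, stub `stub_winningStrategy`. Route-independent (no `Theses` import).

Why two phases: the one-phase rules `KillCentreRule`/`PrincipalCentreRule` ask for a principal centre at EVERY non-terminal model; W3
(`p = 5`, dim 4, `L/w45c/P3-W3.md`) has none at its initial model but dies in two moves (an AUX blow-up of the bad plane, then a uniform
kill). So the strategy alternates AUX moves (any admissible centre, strictly lowering an auxiliary ℕ-measure `F`) and KILL moves (a
principal centre meeting every bad component, `F` non-increasing, `ν₁` dropping by `nu1_principalMove_lt`).

* `NodeAtlas.IsAuxCentre p ρ g₀ 𝒦 d good` (plan-1ʼs notion, verbatim): admissible and principal-or-idle at every point of `good` (F-KR).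
* **`GameFrame.GModel.wins_of_killOrAux`** — THE TWO-PHASE REDUCTION: lex induction on `(F, ν₁)`. (One clause beyond plan-1ʼs SIG is forced
  by the proof: after an AUX move `ν₁` is unconstrained, so the AUX clause must hand over `∃ n, ν₁(Mʼ) < n` — automatic for models of a
  datum over a field, `exists_nat_nu1_lt_of_datum`. The AUX clause only needs `IsAdmissibleCentre`; `IsAuxCentre` is what the RULE promises.)
* **`KillOrAuxRule p`** (OURS CANDIDATE RESIDUAL, asserted nowhere) — per datum, SOME measure `F : GModel → ℕ` with: every non-terminal model
  of finite type over a Noetherian base admits a KILL (principal centre meeting every bad component, `F` non-increasing on its moves) or an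
  AUX centre (`IsAuxCentre … (badLocus)ᶜ`, `F` strictly decreasing on its moves).
* `killOrAuxRule_of_principalCentreRule`, `wins_initial_of_killOrAuxRule`.
-/

set_option linter.dupNamespace false

noncomputable section

open CategoryTheory Limits AlgebraicGeometry TopologicalSpace Topology
open Literature.AlgebraicGeometry.Resolution Literature.AlgebraicGeometry.RelativeSpec
open Summit.ResolutionOfSingularities.ResolutionOfSingularities.Theorems.WildQuotientResolution.S1
open Summit.ResolutionOfSingularities.ResolutionOfSingularities.Theorems.WildQuotientResolution.S1.NodeAtlas

namespace Summit.ResolutionOfSingularities.ResolutionOfSingularities.Theorems.WildQuotientResolution.S1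

universe u

namespace NodeAtlas

variable (p : ℕ) {V Y : Scheme.{u}} {q : V ⟶ Y} {G : Type*} [Group G] (ρ : ActionOver q G) (g₀ : G)

/-- **AUX centre** relative to a set `good ⊆ V` (intended: the complement of the bad locus): an admissible centre which is
PRINCIPAL-OR-IDLE at every point of `good` (F-KR: blowing up a good fixed point non-principally creates bad points). [OURS · L1 W4.5c] -/
def IsAuxCentre (𝒦 : ReesFiltration V) (d : ℕ) (good : Set V) : Prop :=
  IsAdmissibleCentre p ρ g₀ 𝒦 d ∧
    ∀ v ∈ good, ∃ O : ρ.StableAffineOpens, v ∈ O.1 ∧ (IsPrincipalCentreChart p ρ g₀ 𝒦 d O ∨ IsIdleChart p ρ g₀ 𝒦 O)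

variable {p ρ g₀}

/-- A principal centre is an aux centre for every `good`. -/
theorem isAuxCentre_of_isPrincipalCentre {𝒦 : ReesFiltration V} {d : ℕ} (h : IsPrincipalCentre p ρ g₀ 𝒦 d) (good : Set V) :
    IsAuxCentre p ρ g₀ 𝒦 d good :=
  ⟨isAdmissibleCentre_of_isPrincipalCentre h, fun v _ => h.2.2 v⟩

end NodeAtlas

/-- **THE TWO-PHASE (KILL-OR-AUX) RULE at the prime `p`** [OURS · L1 W4.5c — CANDIDATE residual of `stub_winningStrategy`; NOT a statement
of the manuscript, NOT asserted]: for every cyclic action datum there is an auxiliary measure `F : GModel → ℕ` such that every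
non-terminal model of finite type over a Noetherian base fixed by `G` admits EITHER a principal centre whose principal-centre charts meet
every irreducible component of the bad locus and whose moves do not increase `F` (KILL), OR an aux centre (admissible, principal-or-idle
at the good points) all of whose moves strictly decrease `F` and keep `ν₁` finite (AUX). -/
def KillOrAuxRule (p : ℕ) : Prop :=
  ∀ ⦃X' X₁ : Scheme.{0}⦄ (q : X' ⟶ X₁) (G : Type) [Group G] [Finite G] (ρ : G →* Aut X') (g₀ : G),
    (∀ g : G, g ∈ Subgroup.zpowers g₀) →
    ∃ F : GameFrame.GModel p q G ρ g₀ → ℕ, ∀ M : GameFrame.GModel p q G ρ g₀, M.HasNoetherianBase → ¬ M.Terminal →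
      (∃ (𝒦 : ReesFiltration M.V) (d : ℕ), IsPrincipalCentre p M.act g₀ 𝒦 d ∧
        (∀ t ∈ irreducibleComponents ↥M.badLocus, ∃ x ∈ t, (x : M.V) ∈ M.principalKillOpen 𝒦 d) ∧
        ∀ M' : GameFrame.GModel p q G ρ g₀, M.IsMoveOf M' 𝒦 d → F M' ≤ F M) ∨
      (∃ (𝒦 : ReesFiltration M.V) (d : ℕ), IsAuxCentre p M.act g₀ 𝒦 d (M.badLocus)ᶜ ∧
        ∀ M' : GameFrame.GModel p q G ρ g₀, M.IsMoveOf M' 𝒦 d → F M' < F M)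

namespace GameFrame.GModel

variable {p : ℕ} {X' X₁ : Scheme.{0}} {q : X' ⟶ X₁} {G : Type} [Group G] {ρ : G →* Aut X'} {g₀ : G}

/-- **THE TWO-PHASE REDUCTION.** Let `G = ⟨g₀⟩` be finite, `p` prime, `P` a property of models and `F : GModel → ℕ` such that every
non-terminal `P`-model of finite type over a Noetherian base admits EITHER a principal centre whose principal-centre charts meet every
irreducible component of the bad locus, all of whose moves are `P`-models over a Noetherian base with `F` not increased (KILL), OR an
admissible centre all of whose moves are `P`-models over a Noetherian base with finite `ν₁` and `F` strictly decreased (AUX). Then every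
`P`-model over a Noetherian base with finite `ν₁` WINS. Proof: lexicographic induction on `(F, ν₁)`. [OURS · L1 W4.5c] -/
theorem wins_of_killOrAux [Finite G] (hp : p.Prime) (hG : ∀ g : G, g ∈ Subgroup.zpowers g₀)
    (P : GModel p q G ρ g₀ → Prop) (F : GModel p q G ρ g₀ → ℕ)
    (H : ∀ M : GModel p q G ρ g₀, P M → M.HasNoetherianBase → ¬ M.Terminal →
      (∃ (𝒦 : ReesFiltration M.V) (d : ℕ), IsPrincipalCentre p M.act g₀ 𝒦 d ∧
        (∀ t ∈ irreducibleComponents ↥M.badLocus, ∃ x ∈ t, (x : M.V) ∈ M.principalKillOpen 𝒦 d) ∧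
        ∀ M' : GModel p q G ρ g₀, M.IsMoveOf M' 𝒦 d → P M' ∧ M'.HasNoetherianBase ∧ F M' ≤ F M) ∨
      (∃ (𝒦 : ReesFiltration M.V) (d : ℕ), IsAdmissibleCentre p M.act g₀ 𝒦 d ∧
        ∀ M' : GModel p q G ρ g₀, M.IsMoveOf M' 𝒦 d → P M' ∧ M'.HasNoetherianBase ∧ (∃ n : ℕ, M'.nu1 < n) ∧ F M' < F M))
    (M₀ : GModel p q G ρ g₀) (hP₀ : P M₀) (hB₀ : M₀.HasNoetherianBase) {n₀ : ℕ} (hn₀ : M₀.nu1 < n₀) :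
    Wins p q G ρ g₀ M₀ := by
  -- outer induction on the aux measure `F`, inner on `ν₁`
  suffices h : ∀ (a n : ℕ) (M : GModel p q G ρ g₀), P M → M.HasNoetherianBase → F M < a → M.nu1 < n → Wins p q G ρ g₀ M from
    h (F M₀ + 1) n₀ M₀ hP₀ hB₀ (Nat.lt_succ_self _) hn₀
  intro a
  induction a with
  | zero => exact fun n M _ _ ha _ => absurd ha (Nat.not_lt_zero _)
  | succ a iha =>
    intro n
    induction n with
    | zero => exact fun M _ _ _ hn => Wins.terminal M (M.terminal_of_nu1_lt_zero hn)
    | succ n ihn =>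
      intro M hPM hBM ha hn
      by_cases hT : M.Terminal
      · exact Wins.terminal M hT
      rcases H M hPM hBM hT with ⟨𝒦, d, hprin, hhit, hmoves⟩ | ⟨𝒦, d, hadm, hmoves⟩
      · -- KILL move: `ν₁` drops, `F` does not increase
        refine Wins.of_moves 𝒦 d (isAdmissibleCentre_of_isPrincipalCentre hprin) fun M' hmv => ?_
        obtain ⟨hPM', hBM', hF⟩ := hmoves M' hmv
        obtain ⟨π', hbl, -, hr, hcomm⟩ := hmv
        obtain ⟨R₀, _, _, s, _, hs⟩ := hBM
        have hn' : M.nu1 ≤ n := withBot_le_of_lt_succ hn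
        have hν : M'.nu1 < n := nu1_principalMove_lt hp hG M M' 𝒦 d hprin hhit π' hbl hr hcomm s hs hn'
        rcases (Nat.lt_succ_iff.mp (lt_of_le_of_lt hF ha)).lt_or_eq with hlt | heq
        · exact iha n M' hPM' hBM' hlt hν
        · exact ihn M' hPM' hBM' (by rw [heq]; exact Nat.lt_succ_self a) hν
      · -- AUX move: `F` drops strictly
        refine Wins.of_moves 𝒦 d hadm fun M' hmv => ?_
        obtain ⟨hPM', hBM', ⟨m, hm⟩, hF⟩ := hmoves M' hmv
        exact iha m M' hPM' hBM' (lt_of_lt_of_le hF (Nat.lt_succ_iff.mp ha)) hm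

/-- **Every model of a datum over a field has finite `ν₁`** (its underlying scheme is of finite type over `k` and quasi-compact). -/
theorem exists_nat_nu1_lt_of_datum {k : Type} [Field k] (f : X₁ ⟶ Spec (.of k)) [LocallyOfFiniteType f] [QuasiCompact f] [IsFinite q]
    (M : GModel p q G ρ g₀) : ∃ n : ℕ, M.nu1 < n := by
  haveI := M.isProper
  have hr : M.r = M.π ≫ q := M.r_eq
  haveI : LocallyOfFiniteType (M.r ≫ f) := by rw [hr]; infer_instance
  haveI : QuasiCompact (M.r ≫ f) := by rw [hr]; infer_instance
  haveI : CompactSpace M.V := (HasAffineProperty.iff_of_isAffine (P := @QuasiCompact)).mp ‹QuasiCompact (M.r ≫ f)›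
  obtain ⟨n, hn⟩ := exists_topologicalKrullDim_le_of_locallyOfFiniteType (M.r ≫ f)
  exact ⟨n + 1, lt_of_le_of_lt (M.nu1_le.trans hn) (by exact_mod_cast Nat.lt_succ_self n)⟩

/-- The one-phase rule is the KILL-only case of the two-phase rule (`F := 0`). -/
theorem _root_.Summit.ResolutionOfSingularities.ResolutionOfSingularities.Theorems.WildQuotientResolution.S1.killOrAuxRule_of_principalCentreRule
    (hrule : PrincipalCentreRule p) : KillOrAuxRule p := by
  intro X' X₁ q G _ _ ρ g₀ hG
  refine ⟨fun _ => 0, fun M hB hT => Or.inl ?_⟩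
  obtain ⟨𝒦, d, hprin, hhit⟩ := hrule q G ρ g₀ hG M hB hT
  refine ⟨𝒦, d, hprin, fun t ht => ?_, fun _ _ => le_rfl⟩
  obtain ⟨x, hxt, O, hO, hxO⟩ := hhit t ht
  exact ⟨x, hxt, Set.mem_iUnion.mpr ⟨O, Set.mem_iUnion.mpr ⟨hO, hxO⟩⟩⟩

/-- **The two-phase rule makes the initial model of every datum over a field win.** [OURS · L1 W4.5c] -/
theorem wins_initial_of_killOrAuxRule (hp : p.Prime) (hrule : KillOrAuxRule p) {k : Type} [Field k] (f : X₁ ⟶ Spec (.of k))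
    [LocallyOfFiniteType f] [QuasiCompact f] [IsFinite q] [Finite G] (hG : ∀ g : G, g ∈ Subgroup.zpowers g₀)
    (hq : ∀ g : G, (ρ g).hom ≫ q = q) [IsIntegral X'] [IsLocallyNoetherian X'] (h₀ : NodeAtlas p (⟨ρ, hq⟩ : ActionOver q G) g₀) :
    Wins p q G ρ g₀ (GModel.initial hq h₀) := by
  obtain ⟨F, hF⟩ := hrule q G ρ g₀ hG
  obtain ⟨n₀, hn₀⟩ := exists_nat_nu1_lt_of_datum f (GModel.initial (p := p) (g₀ := g₀) hq h₀)
  refine wins_of_killOrAux hp hG (fun _ => True) F (fun M _ hB hT => ?_) (GModel.initial hq h₀) trivial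
    (hasNoetherianBase_of_datum f _) hn₀
  rcases hF M hB hT with ⟨𝒦, d, hprin, hhit, hmoves⟩ | ⟨𝒦, d, haux, hmoves⟩
  · exact Or.inl ⟨𝒦, d, hprin, hhit, fun M' hmv => ⟨trivial, hasNoetherianBase_of_datum f M', hmoves M' hmv⟩⟩
  · exact Or.inr ⟨𝒦, d, haux.1, fun M' hmv =>
      ⟨trivial, hasNoetherianBase_of_datum f M', exists_nat_nu1_lt_of_datum f M', hmoves M' hmv⟩⟩

end GameFrame.GModel

end Summit.ResolutionOfSingularities.ResolutionOfSingularities.Theorems.WildQuotientResolution.S1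

end
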